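import Summits.QuantumFields.YangMills.Theorems.UnitScaleTiltProp7SymAvgTwSymDefs
import Summits.QuantumFields.YangMills.Theorems.UnitScaleTiltProp7ChartVelocityDexp
import Literature.MathematicalPhysics.QuantumFieldTheory.Balaban1983to89.B7Eq170Flat
import HarnessLib

/-!
# Route `UnitScaleTilt`, crux K1 child «MinimiserStabilityRegPr» (stmt-QuantumFields-19200), skeleton v10, stub `stub_existenceMinimalOrbit` (EX), route (α) — **GLUE BETWEEN THE TWO LETTERINGS OF
# THE FRAME RESPONSE: the complex Fréchet derivative `D(v(·)(y))(A₁)γ` of T2/T4 (✓`Prop7TwistedSliceTangent`, ✓`Prop7TwistedSliceGaugeOnto`) along the chart velocity `γ` of a gauge direction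
# EQUALS the real derivative of the accumulated frame tower along the gauge orbit `U′^{exp(tN)}` of FR₁ (✓`Prop7SymFrameGaugeResponseAt`)** — so that T4's solvability hypothesis `hK` reads on
# FR₁'s tower letters («top-down solvability of the perturbed averaging recursion»).

Cell `ym3-torus`, width seat `ym-ust-20520-w5` (gen 6).  THEOREMS ONLY (0 `def`, 0 `sorry`).  `--supports stmt-QuantumFields-19200 --as helper`, count-neutral.  YM₃ on T³ is a ladder rung (R3), not
the Clay problem; nothing here claims the stub, the crux, d = 4 or the mass gap.

WHAT IS PROVED (sorry-free, no definition): §1 ★★`fderiv_frameTwS_apply_eq_of_chartCurve` — if `c` is a real curve of exponent fields through `A₁` with velocity `γ` whose configurations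
`e^{c_t}U₀♭` are (eventually) the gauge orbit `(U′♭)^{g_t}`, then `D(v(·)(y))(A₁)γ = d∕dt|₀ frameAccU (K−n) U₀♭ ((U′♭)^{g_t}) ŷ` (chain rule + uniqueness of the derivative; `v` differentiable at
`A₁`, e.g. ✓`hasFDerivAt_frameTwS_at_of_regPr`); §2 `hasDerivAt_conjCurve_real`, `dexp_comp_fderiv_mlog_apply` (`dexp_{A}(D log(e^{A}) Z) = Z`), and ★★`exists_chartCurve_of_gaugeDir` — for
`U′(b) = e^{A₁(b)}U₀(b)` with `‖A₁(b)‖ ≤ 1/5` and any site field `N`, the chart curve `c_t(b) = log(e^{tN(b₋)}U′(b)e^{−tN(b₊)}U₀(b)⁻¹)` has `c_0 = A₁`, a velocity `γ` with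
**`g(ad(−A₁(b)))γ(b) = N(b₋) − U′(b)N(b₊)U′(b)⁻¹`** (the `hγ` letter of T4), and `e^{c_t}U₀♭ = (U′♭)^{exp(tN)}` for all small real `t`.
HONEST SCOPE: exact calculus bookkeeping; nothing of print is asserted.

References: T. Bałaban, CMP 98 (1985) 17–51 [Balaban1985Averaging] ((8)–(9) p.18, (21)–(27) p.22, (97) p.32); CMP 102 (1985) 277–309 [Balaban1985Variational] ((44)–(49) p.285).
-/

set_option autoImplicit false

noncomputable section

open scoped BigOperators Topology Matrix.Norms.L2Operator
open Filter NormedSpace Metric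

namespace Summit.QuantumFields.YangMills.Theorems.Prop7FrameResponseChartGlue

open Literature.MathematicalPhysics.QuantumFieldTheory.Balaban1983to89
open T4Continuum BlockAveraging ExpMeanLog MatrixLog
open T3ContinuumYM3Torus
open T3LevelShift (siteShift)
open T3PrintedRegularOrbits (sites_eq)
open T3SectALandauChart (bgUnits)
open B10Eq27TorusAxialLog (gaugeActT gaugeActT_apply)
open B7Prop1Explicit (expUnit val_expUnit val_inv_expUnit)
open Literature.Analysis.Calculus.ExpDifferential (ad gSer dexp hasFDerivAt_exp_dexp)
open Summit.QuantumFields.YangMills.Theorems.Prop7SymAvgTwSym (frameAccU frameTwS frameTwS_def)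
open Summit.QuantumFields.YangMills.Theorems.Prop7ChartVelocityDexp (dexp_apply_mul_exp_neg)

variable (F : T3Family) {n K : ℕ} (h : n ≤ K)

/-! ## §1 The complex Fréchet derivative of the accumulated frame along a chart velocity is the real derivative of the tower along the gauge orbit -/

/-- ★★ **GLUE**: `D(v(·)(y))(A₁)γ = d∕dt|₀ v_{K−n}(U₀♭, (U′♭)^{g_t})(ŷ)` whenever `e^{c_t}U₀♭ = (U′♭)^{g_t}` for small `t`, `c_0 = A₁`, `ċ_0 = γ`. [cite: Balaban1985Averaging, (97) p.32; Balaban1985Variational, (44)-(49) p.285] -/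
theorem fderiv_frameTwS_apply_eq_of_chartCurve (U₀ U' : GaugeField (F.P K) 0 (Matrix.specialUnitaryGroup (Fin 2) ℂ))
    (A₁ : PBond (F.P K) 0 → Matrix (Fin 2) (Fin 2) ℂ) (y : Site (F.P n) 0)
    (hΦ : DifferentiableAt ℂ (fun A : PBond (F.P K) 0 → Matrix (Fin 2) (Fin 2) ℂ => ((frameTwS F n K h U₀ A y : (Matrix (Fin 2) (Fin 2) ℂ)ˣ) : Matrix (Fin 2) (Fin 2) ℂ)) A₁)
    {c : ℝ → PBond (F.P K) 0 → Matrix (Fin 2) (Fin 2) ℂ} {γ : PBond (F.P K) 0 → Matrix (Fin 2) (Fin 2) ℂ} (hc0 : c 0 = A₁) (hcd : HasDerivAt c γ 0)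
    {g : ℝ → Site (F.P K) 0 → (Matrix (Fin 2) (Fin 2) ℂ)ˣ}
    (hcg : ∀ᶠ t : ℝ in 𝓝 0, (fun b : PBond (F.P K) 0 => expUnit (c t b) * bgUnits F K U₀ b) = gaugeActT (g t) (bgUnits F K U'))
    {V : Matrix (Fin 2) (Fin 2) ℂ}
    (hF : HasDerivAt (fun t : ℝ => ((frameAccU (K - n) (bgUnits F K U₀) (gaugeActT (g t) (bgUnits F K U')) (siteShift (sites_eq F n K h) y) : (Matrix (Fin 2) (Fin 2) ℂ)ˣ) :
        Matrix (Fin 2) (Fin 2) ℂ)) V 0) :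
    fderiv ℂ (fun A : PBond (F.P K) 0 → Matrix (Fin 2) (Fin 2) ℂ => ((frameTwS F n K h U₀ A y : (Matrix (Fin 2) (Fin 2) ℂ)ˣ) : Matrix (Fin 2) (Fin 2) ℂ)) A₁ γ = V := by
  have h1 : HasDerivAt (fun t : ℝ => ((frameTwS F n K h U₀ (c t) y : (Matrix (Fin 2) (Fin 2) ℂ)ˣ) : Matrix (Fin 2) (Fin 2) ℂ))
      (fderiv ℂ (fun A : PBond (F.P K) 0 → Matrix (Fin 2) (Fin 2) ℂ => ((frameTwS F n K h U₀ A y : (Matrix (Fin 2) (Fin 2) ℂ)ˣ) : Matrix (Fin 2) (Fin 2) ℂ)) A₁ γ) 0 := by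
    have hcomp := ((hΦ.hasFDerivAt).restrictScalars ℝ).comp_hasDerivAt_of_eq (0 : ℝ) hcd hc0.symm
    exact hcomp
  have h2 : (fun t : ℝ => ((frameAccU (K - n) (bgUnits F K U₀) (gaugeActT (g t) (bgUnits F K U')) (siteShift (sites_eq F n K h) y) : (Matrix (Fin 2) (Fin 2) ℂ)ˣ) :
        Matrix (Fin 2) (Fin 2) ℂ))
      =ᶠ[𝓝 0] fun t : ℝ => ((frameTwS F n K h U₀ (c t) y : (Matrix (Fin 2) (Fin 2) ℂ)ˣ) : Matrix (Fin 2) (Fin 2) ℂ) := by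
    filter_upwards [hcg] with t ht
    rw [frameTwS_def, ht]
  exact (h1.congr_of_eventuallyEq h2).unique hF ▸ rfl

/-! ## §2 The chart curve of the gauge orbit through `U′ = e^{A₁}U₀` and its velocity -/

section Curve

open Literature.Analysis.Calculus.ExpDifferential (exp_mul_exp_neg_eq_one)
open B7TransferAnalyticMean (norm_exp_sub_one_le_two_mul)
open B7Eq170Flat (mlog_exp_of_le)

/-- `d∕dt|₀ (e^{tX}·M·e^{−tY}·R) = X·M·R − M·Y·R` (real parameter). [cite: Balaban1985Averaging, (21)-(27) p.22] -/
theorem hasDerivAt_conjCurve_real {𝔸 : Type*} [NormedRing 𝔸] [NormedAlgebra ℂ 𝔸] [CompleteSpace 𝔸] (X Y M R : 𝔸) :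
    HasDerivAt (fun t : ℝ => exp (t • X) * M * exp (t • (-Y)) * R) (X * M * R - M * Y * R) 0 := by
  have hA : HasDerivAt (fun t : ℝ => exp (t • X)) X 0 := by
    simpa using hasDerivAt_exp_smul_const' (𝕂 := ℝ) X 0
  have hB : HasDerivAt (fun t : ℝ => exp (t • (-Y))) (-Y) 0 := by
    simpa using hasDerivAt_exp_smul_const' (𝕂 := ℝ) (-Y) 0
  have h := ((hA.mul_const M).mul hB).mul_const R
  refine h.congr_deriv ?_
  simp only [zero_smul, exp_zero, mul_one, one_mul, mul_neg, neg_mul, add_mul]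
  rw [sub_eq_add_neg]

/-- **`dexp_A ∘ D log(e^{A}) = id`**: differentiate `exp (log Y) = Y` at `Y = e^{A}` inside the `log` window. [folklore] -/
theorem dexp_comp_fderiv_mlog_apply {𝔸 : Type*} [NormedRing 𝔸] [NormedAlgebra ℂ 𝔸] [CompleteSpace 𝔸] (A Z : 𝔸) (hA : ‖exp A - 1‖ < 1)
    (hlog : mlog (exp A) = A) : dexp ℂ A (fderiv ℂ (mlog : 𝔸 → 𝔸) (exp A) Z) = Z := by
  have hml : HasFDerivAt (mlog : 𝔸 → 𝔸) (fderiv ℂ (mlog : 𝔸 → 𝔸) (exp A)) (exp A) := (MatrixLog.analyticAt_mlog hA).differentiableAt.hasFDerivAt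
  have hex : HasFDerivAt (exp : 𝔸 → 𝔸) (dexp ℂ A) (mlog (exp A)) := by
    rw [hlog]; exact hasFDerivAt_exp_dexp (𝕂 := ℂ) A
  have hcomp : HasFDerivAt (fun Y : 𝔸 => exp (mlog Y)) ((dexp ℂ A).comp (fderiv ℂ (mlog : 𝔸 → 𝔸) (exp A))) (exp A) := hex.comp (exp A) hml
  have hEq : (fun Y : 𝔸 => exp (mlog Y)) =ᶠ[𝓝 (exp A)] id := by
    have hopen : ∀ᶠ Y in 𝓝 (exp A), ‖Y - 1‖ < 1 := by
      have hmem : exp A ∈ ball (1 : 𝔸) 1 := by rw [mem_ball_iff_norm]; exact hA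
      filter_upwards [isOpen_ball.mem_nhds hmem] with Y hY
      rw [mem_ball_iff_norm] at hY; exact hY
    filter_upwards [hopen] with Y hY
    exact exp_mlog hY
  have hid : HasFDerivAt (fun Y : 𝔸 => exp (mlog Y)) (ContinuousLinearMap.id ℂ 𝔸) (exp A) := (hasFDerivAt_id (exp A)).congr_of_eventuallyEq hEq
  have huniq := hcomp.unique hid
  have := congrArg (fun L : 𝔸 →L[ℂ] 𝔸 => L Z) huniq
  simpa using this

variable (F : T3Family) {n K : ℕ} (h : n ≤ K)

/-- ★★ **THE CHART CURVE OF THE GAUGE ORBIT THROUGH `U′ = e^{A₁}U₀` AND ITS VELOCITY.**  For `‖A₁(b)‖ ≤ 1/5` and any site field `N`, the exponent curve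
`c_t(b) = log(e^{tN(b₋)}·U′(b)·e^{−tN(b₊)}·U₀(b)⁻¹)` satisfies `c_0 = A₁`, has a velocity `γ` at `t = 0` with `g(ad(−A₁(b)))γ(b) = N(b₋) − U′(b)N(b₊)U′(b)⁻¹` (the gauge direction of `N` at `U′`), and
`e^{c_t}U₀♭ = (U′♭)^{exp(tN)}` for all small real `t`. [cite: Balaban1985Averaging, (8)-(9) p.18, (21)-(27) p.22; Balaban1985Variational, (44)-(49) p.285] -/
theorem exists_chartCurve_of_gaugeDir (U₀ U' : GaugeField (F.P K) 0 (Matrix.specialUnitaryGroup (Fin 2) ℂ)) (A₁ : PBond (F.P K) 0 → Matrix (Fin 2) (Fin 2) ℂ)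
    (hA₁ : ∀ b, ‖A₁ b‖ ≤ 1 / 5)
    (hU' : ∀ b, ((U' b : Matrix.specialUnitaryGroup (Fin 2) ℂ) : Matrix (Fin 2) (Fin 2) ℂ) = exp (A₁ b) * ((U₀ b : Matrix.specialUnitaryGroup (Fin 2) ℂ) : Matrix (Fin 2) (Fin 2) ℂ))
    (N : Site (F.P K) 0 → Matrix (Fin 2) (Fin 2) ℂ) :
    ∃ (c : ℝ → PBond (F.P K) 0 → Matrix (Fin 2) (Fin 2) ℂ) (γ : PBond (F.P K) 0 → Matrix (Fin 2) (Fin 2) ℂ),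
      c 0 = A₁ ∧ HasDerivAt c γ 0 ∧
      (∀ b, gSer ℂ (ad ℂ (-A₁ b)) (γ b) = N b.src - ((bgUnits F K U' b : (Matrix (Fin 2) (Fin 2) ℂ)ˣ) : Matrix (Fin 2) (Fin 2) ℂ) * N b.tgt *
          (((bgUnits F K U' b)⁻¹ : (Matrix (Fin 2) (Fin 2) ℂ)ˣ) : Matrix (Fin 2) (Fin 2) ℂ)) ∧
      ∀ᶠ t : ℝ in 𝓝 0, (fun b : PBond (F.P K) 0 => expUnit (c t b) * bgUnits F K U₀ b) = gaugeActT (fun x : Site (F.P K) 0 => expUnit (t • N x)) (bgUnits F K U') := by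
  -- the product curve `Y_t(b) = e^{tN(b₋)}·U′(b)·e^{−tN(b₊)}·U₀(b)⁻¹` and its value `e^{A₁(b)}` at `0`
  have hWP : ∀ b, bgUnits F K U' b = expUnit (A₁ b) * bgUnits F K U₀ b := fun b => by
    apply Units.ext; rw [Units.val_mul, val_expUnit]; exact hU' b
  have hPinv : ∀ b, (((bgUnits F K U₀ b)⁻¹ : (Matrix (Fin 2) (Fin 2) ℂ)ˣ) : Matrix (Fin 2) (Fin 2) ℂ)
      = (((bgUnits F K U' b)⁻¹ : (Matrix (Fin 2) (Fin 2) ℂ)ˣ) : Matrix (Fin 2) (Fin 2) ℂ) * exp (A₁ b) := fun b => by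
    rw [hWP b, mul_inv_rev, Units.val_mul, val_inv_expUnit, val_expUnit, mul_assoc, Literature.Analysis.Calculus.ExpDifferential.exp_neg_mul_exp_eq_one (𝕂 := ℂ), mul_one]
  have hY0 : ∀ b, exp ((0 : ℝ) • N b.src) * ((bgUnits F K U' b : (Matrix (Fin 2) (Fin 2) ℂ)ˣ) : Matrix (Fin 2) (Fin 2) ℂ) * exp ((0 : ℝ) • (-N b.tgt)) *
      (((bgUnits F K U₀ b)⁻¹ : (Matrix (Fin 2) (Fin 2) ℂ)ˣ) : Matrix (Fin 2) (Fin 2) ℂ) = exp (A₁ b) := fun b => by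
    rw [zero_smul, zero_smul, exp_zero, one_mul, mul_one, hWP b, Units.val_mul, val_expUnit, Units.mul_inv_cancel_right]
  have hexp1 : ∀ b, ‖exp (A₁ b) - 1‖ < 1 := fun b =>
    (norm_exp_sub_one_le_two_mul ((hA₁ b).trans (by norm_num))).trans_lt (by linarith [hA₁ b])
  have hlog : ∀ b, mlog (exp (A₁ b)) = A₁ b := fun b => mlog_exp_of_le (hA₁ b)
  -- derivative of `Y_·(b)` at `0`
  have hYd : ∀ b, HasDerivAt (fun t : ℝ => exp (t • N b.src) * ((bgUnits F K U' b : (Matrix (Fin 2) (Fin 2) ℂ)ˣ) : Matrix (Fin 2) (Fin 2) ℂ) * exp (t • (-N b.tgt)) *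
        (((bgUnits F K U₀ b)⁻¹ : (Matrix (Fin 2) (Fin 2) ℂ)ˣ) : Matrix (Fin 2) (Fin 2) ℂ))
      (N b.src * ((bgUnits F K U' b : (Matrix (Fin 2) (Fin 2) ℂ)ˣ) : Matrix (Fin 2) (Fin 2) ℂ) * (((bgUnits F K U₀ b)⁻¹ : (Matrix (Fin 2) (Fin 2) ℂ)ˣ) : Matrix (Fin 2) (Fin 2) ℂ)
        - ((bgUnits F K U' b : (Matrix (Fin 2) (Fin 2) ℂ)ˣ) : Matrix (Fin 2) (Fin 2) ℂ) * N b.tgt * (((bgUnits F K U₀ b)⁻¹ : (Matrix (Fin 2) (Fin 2) ℂ)ˣ) : Matrix (Fin 2) (Fin 2) ℂ)) 0 :=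
    fun b => hasDerivAt_conjCurve_real (N b.src) (N b.tgt) _ _
  refine ⟨fun t b => mlog (exp (t • N b.src) * ((bgUnits F K U' b : (Matrix (Fin 2) (Fin 2) ℂ)ˣ) : Matrix (Fin 2) (Fin 2) ℂ) * exp (t • (-N b.tgt)) *
      (((bgUnits F K U₀ b)⁻¹ : (Matrix (Fin 2) (Fin 2) ℂ)ˣ) : Matrix (Fin 2) (Fin 2) ℂ)),
    fun b => fderiv ℂ (mlog : Matrix (Fin 2) (Fin 2) ℂ → Matrix (Fin 2) (Fin 2) ℂ) (exp (A₁ b))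
      (N b.src * ((bgUnits F K U' b : (Matrix (Fin 2) (Fin 2) ℂ)ˣ) : Matrix (Fin 2) (Fin 2) ℂ) * (((bgUnits F K U₀ b)⁻¹ : (Matrix (Fin 2) (Fin 2) ℂ)ˣ) : Matrix (Fin 2) (Fin 2) ℂ)
        - ((bgUnits F K U' b : (Matrix (Fin 2) (Fin 2) ℂ)ˣ) : Matrix (Fin 2) (Fin 2) ℂ) * N b.tgt * (((bgUnits F K U₀ b)⁻¹ : (Matrix (Fin 2) (Fin 2) ℂ)ˣ) : Matrix (Fin 2) (Fin 2) ℂ)),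
    ?_, ?_, ?_, ?_⟩
  · -- `c_0 = A₁`
    funext b
    show mlog _ = A₁ b
    rw [hY0, hlog]
  · -- `ċ_0 = γ`
    refine hasDerivAt_pi.2 fun b => ?_
    have hml : HasFDerivAt (mlog : Matrix (Fin 2) (Fin 2) ℂ → Matrix (Fin 2) (Fin 2) ℂ) (fderiv ℂ (mlog : Matrix (Fin 2) (Fin 2) ℂ → Matrix (Fin 2) (Fin 2) ℂ) (exp (A₁ b)))
        (exp ((0 : ℝ) • N b.src) * ((bgUnits F K U' b : (Matrix (Fin 2) (Fin 2) ℂ)ˣ) : Matrix (Fin 2) (Fin 2) ℂ) * exp ((0 : ℝ) • (-N b.tgt)) *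
          (((bgUnits F K U₀ b)⁻¹ : (Matrix (Fin 2) (Fin 2) ℂ)ˣ) : Matrix (Fin 2) (Fin 2) ℂ)) := by
      rw [hY0]; exact (MatrixLog.analyticAt_mlog (hexp1 b)).differentiableAt.hasFDerivAt
    exact (hml.restrictScalars ℝ).comp_hasDerivAt (0 : ℝ) (hYd b)
  · -- the velocity constraint `Mγ = G_{U′}N`
    intro b
    rw [← dexp_apply_mul_exp_neg, dexp_comp_fderiv_mlog_apply (A₁ b) _ (hexp1 b) (hlog b), hPinv b]
    simp only [mul_assoc, sub_mul]
    rw [exp_mul_exp_neg_eq_one (𝕂 := ℂ)]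
    simp only [mul_one, Units.mul_inv]
  · -- the configurations are the gauge orbit, inside the `log` window
    have hall : ∀ᶠ t : ℝ in 𝓝 0, ∀ b : PBond (F.P K) 0,
        ‖exp (t • N b.src) * ((bgUnits F K U' b : (Matrix (Fin 2) (Fin 2) ℂ)ˣ) : Matrix (Fin 2) (Fin 2) ℂ) * exp (t • (-N b.tgt)) *
            (((bgUnits F K U₀ b)⁻¹ : (Matrix (Fin 2) (Fin 2) ℂ)ˣ) : Matrix (Fin 2) (Fin 2) ℂ) - 1‖ < 1 := by
      refine eventually_all.2 fun b => ?_
      have hmem : exp ((0 : ℝ) • N b.src) * ((bgUnits F K U' b : (Matrix (Fin 2) (Fin 2) ℂ)ˣ) : Matrix (Fin 2) (Fin 2) ℂ) * exp ((0 : ℝ) • (-N b.tgt)) *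
          (((bgUnits F K U₀ b)⁻¹ : (Matrix (Fin 2) (Fin 2) ℂ)ˣ) : Matrix (Fin 2) (Fin 2) ℂ) ∈ ball (1 : Matrix (Fin 2) (Fin 2) ℂ) 1 := by
        rw [mem_ball_iff_norm, hY0]; exact hexp1 b
      filter_upwards [(hYd b).continuousAt.eventually_mem (isOpen_ball.mem_nhds hmem)] with t ht
      rw [mem_ball_iff_norm] at ht; exact ht
    filter_upwards [hall] with t ht
    funext b
    apply Units.ext
    rw [Units.val_mul, val_expUnit, exp_mlog (ht b), gaugeActT_apply, Units.val_mul, Units.val_mul, val_expUnit, val_inv_expUnit, val_expUnit, smul_neg,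
      Units.inv_mul_cancel_right]

end Curve

end Summit.QuantumFields.YangMills.Theorems.Prop7FrameResponseChartGlue

end
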